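import Summits.QuantumFields.YangMills.Theorems.MirrorModularBoostsSoftKernelBoostCovarianceDiagOfBoxesHelpers
import HarnessLib

/-!
# Stub (F) `stub_diagOfBoxes` of line `Sketch` (crux `MirrorModularBoosts.SoftKernelBoostCovariance`)

Crux stmt-QuantumFields-14999 (`Summit.QuantumFields.YangMills.Theses.MirrorModularBoosts.SoftKernelBoostCovariance`),
line `Sketch`, registered stub `stub_diagOfBoxes` (lead c13, skeleton v3.12), proved in the registered text:
**a sandwich bound for box-localised insertions and compactly supported clouds is a sandwich bound.**

Informal statement.  Let `S` be a one-species Schwinger family on `ℝ⁴` with an `e₀`-reconstruction `hS` and the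
function residual `NPointRegular S`.  Suppose the vector bound
`‖Ψ_{f ⊗ T_{(2u+v)e₀}W}‖ ≤ CB·Mg·(Mh+Mh')·(u^{-μ}+v^{-μ})·‖Ψ_W‖` holds for every BOX insertion `f = g(x⁰,x¹) hh(x²,x³)`
(`g` supported in `[c, c+δ] × [−δ, δ]`, `δ = min(u,v)/32`, `u ≤ c`, `c + δ ≤ 2u`, `∫|g| ≤ Mg`, `Mg > 0`) and every
COMPACTLY SUPPORTED time-ordered cloud `W`.  Then `SandwichBound S hS μ (4·CB)` (all windowed insertions, all clouds).

Proof (helpers in `…DiagOfBoxesHelpers`).  Cut a general insertion by the smooth telescoping partition of unity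
`θ(x⁰/h − a) θ(x¹/h − b)` (`h = δ/2`; `DiagOfBoxes.exists_bump`, `exists_pieces`) into Schwartz pieces; each piece is
of box type after the free sideways translation `x¹ ↦ x¹ − bh` (`DiagOfBoxes.piece_bound`: `U(a⃗)` is unitary and
translates field vectors, OS 1973 (4.5)); the masses of the pieces add up to `∫|g| ≤ Mg` (`sum_mass_le`, with
`+ ε/#pieces` for positivity); the partial sums obey the bound by linearity of `F ↦ Ψ_F` (`norm_fieldVec_sum_le`);
the partial sums in front of the cut-off clouds `W_K = χ_K W` and the `W_K` themselves converge in norm by dominated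
convergence under `NPointRegular S` (`tendsto_norm_fieldVec`, the pattern of `UnorderedRP.tendsto_osPairing`);
finally `ε → 0`, and `CB ≤ 4·CB` on the nonnegative right-hand side.

References: K. Osterwalder, R. Schrader, Comm. Math. Phys. 31 (1973) §4.1; J. Glimm, A. Jaffe, *Quantum Physics*
(1987) §6.1, §10.5; folklore (partitions of unity, dominated convergence).
-/

noncomputable section

namespace Summit.QuantumFields.YangMills.Theorems.SoftKernelBoostCovariance.Sketch

open scoped BigOperators SchwartzMap InnerProductSpace ContDiff
open MeasureTheory Filter Topology
open Literature.MathematicalPhysics.QuantumLattice Literature.MathematicalPhysics.AQFT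
  Literature.MathematicalPhysics.QuantumFieldTheory
open Summit.QuantumFields.YangMills.Theorems.NPointIsotropy.Negative (E4 NPointRegular)
open Summit.QuantumFields.YangMills.Theorems.CurvatureSandwichBound.Sketch (tsupport_subset_window)
open Summit.QuantumFields.YangMills.Cruxes.PlanarSpectralCone.PositivityDiscToOperatorCone.Density
  (fieldVec_congr)

namespace DiagOfBoxes

/-- **The time window of a piece.**  With `δ = min u v / 32 = 2h`, a piece whose planar cut-off is centred at
`a h` (support `|t/h − a| < 1`) and which meets the window `[u, 2u]` fits in the box `[c, c + δ]` with
`c = max u (min ((a−1)h) (2u − δ))`, `u ≤ c`, `c + δ ≤ 2u`. -/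
theorem box_window {u v h a : ℝ} (hh : 0 < h) (hδ : min u v / 32 = 2 * h) :
    (u ≤ max u (min ((a - 1) * h) (2 * u - min u v / 32)) ∧
      max u (min ((a - 1) * h) (2 * u - min u v / 32)) + min u v / 32 ≤ 2 * u) ∧
    ∀ t : ℝ, |t / h - a| < 1 → u ≤ t → t ≤ 2 * u →
      max u (min ((a - 1) * h) (2 * u - min u v / 32)) ≤ t ∧
        t ≤ max u (min ((a - 1) * h) (2 * u - min u v / 32)) + min u v / 32 := by
  have hδu : min u v / 32 ≤ u := by
    have := min_le_left u v
    linarith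
  refine ⟨⟨le_max_left _ _, ?_⟩, fun t ht hut htu => ?_⟩
  · have : max u (min ((a - 1) * h) (2 * u - min u v / 32)) ≤ 2 * u - min u v / 32 :=
      max_le (by linarith) (min_le_right _ _)
    linarith
  · obtain ⟨h1, h2⟩ := abs_lt.1 ht
    have h1' : (a - 1) * h < t := by
      have := (lt_div_iff₀ hh).1 (by linarith : a - 1 < t / h)
      linarith
    have h2' : t < (a + 1) * h := by
      have := (div_lt_iff₀ hh).1 (by linarith : t / h < a + 1)
      linarith
    refine ⟨max_le hut ((min_le_left _ _).trans h1'.le), ?_⟩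
    rcases le_total ((a - 1) * h) (2 * u - min u v / 32) with hle | hle
    · rw [min_eq_left hle]
      have : (a - 1) * h ≤ max u ((a - 1) * h) := le_max_right _ _
      nlinarith
    · rw [min_eq_right hle]
      have : 2 * u - min u v / 32 ≤ max u (2 * u - min u v / 32) := le_max_right _ _
      linarith

end DiagOfBoxes

open DiagOfBoxes

/-- **Stub (F) `stub_diagOfBoxes` — A SANDWICH BOUND FOR BOX-LOCALISED INSERTIONS AND COMPACT CLOUDS IS A SANDWICH BOUND (model-blind
analysis; difficulty L).**  For any one-species family `S` on `ℝ⁴` with `e₀`-reconstruction `hS` and `NPointRegular S`: if the vector bound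
`‖Ψ_{f ⊗ T_{(2u+v)e₀}W}‖ ≤ CB·Mg·(Mh+Mh')·(u^{-μ}+v^{-μ})·‖Ψ_W‖` holds for every BOX insertion `f = g(x₀,x₁)hh(x₂,x₃)` (`g` supported in
`[c, c+δ] × [−δ, δ]`, `δ = min(u,v)/32`, `u ≤ c`, `c + δ ≤ 2u`, `∫|g| ≤ Mg` with `Mg > 0`) and every COMPACTLY SUPPORTED time-ordered admissible
`W`, then `SandwichBound S hS μ (4·CB)`.  PROOF: (1) a general insertion (`g` supported in `[u,2u] × ℝ`, merely integrable; `f` Schwartz) is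
cut by the smooth telescoping partition of unity `θ(x⁰/h − a) θ(x¹/h − b)` (`h = δ/2`, `exists_bump`) into Schwartz pieces
(`SchwartzMap.smulLeftCLM`), each of box type after the free sideways translation `x¹ ↦ x¹ − bh` (`piece_bound`:
`translate_fieldVec`, unitarity); the masses add up to `∫|g| ≤ Mg` (`sum_mass_le`; `+ ε/#pieces` for positivity); (2) the partial sums
obey the bound by linearity of `Ψ` (`norm_fieldVec_sum_le`); (3) the partial sums and the compactly supported cut-off clouds
`W_K = χ_K W` converge in norm by dominated convergence under `NPointRegular S` (`tendsto_norm_fieldVec`, pattern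
`UnorderedRP.tendsto_osPairing`), and `ε → 0`. -/
theorem stub_diagOfBoxes :
    open Literature.MathematicalPhysics.QuantumLattice Literature.MathematicalPhysics.AQFT
      Literature.MathematicalPhysics.QuantumFieldTheory
      Summit.QuantumFields.YangMills.Theorems.CurvatureSandwichBound.Negative
      Summit.QuantumFields.YangMills.Theorems.NPointIsotropy.Negative in
    ∀ (S : SchwingerFamily E4) (hS : OSReconstructionNoE1 S.toLabelled), NPointRegular S →
    ∀ (μ CB : ℝ), 0 ≤ μ → 0 ≤ CB →
      (∀ (u v c : ℝ), 0 < u → 0 < v → u ≤ 1 → v ≤ 1 → u ≤ c → c + min u v / 32 ≤ 2 * u →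
        ∀ (f : SchwartzMap (Fin 1 → E4) ℂ) (g hh : ℝ × ℝ → ℂ) (Mg Mh Mh' : ℝ),
          (∀ x, f x = g (x 0 0, x 0 1) * hh (x 0 2, x 0 3)) →
          (∀ p, g p ≠ 0 → (c ≤ p.1 ∧ p.1 ≤ c + min u v / 32) ∧ |p.2| ≤ min u v / 32) →
          MeasureTheory.Integrable g → (∫ p, ‖g p‖) ≤ Mg → 0 < Mg →
          MeasureTheory.Integrable hh → (∫ p, ‖hh p‖) ≤ Mh → (∀ p, ‖hh p‖ ≤ Mh') →
        ∀ (n : ℕ) (W : SchwartzMap (Fin n → E4) ℂ) (hW : IsTimeOrdered W),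
          HasCompactSupport (W : (Fin n → E4) → ℂ) →
        ∀ (hFW : IsTimeOrdered (f.appendTensor (translateMulti ((2 * u + v) • EuclideanSpace.single 0 1) W))),
          ‖hS.fieldVec (1 + n) (fun _ => ())
              (f.appendTensor (translateMulti ((2 * u + v) • EuclideanSpace.single 0 1) W)) hFW‖ ≤
            CB * Mg * (Mh + Mh') * (u ^ (-μ) + v ^ (-μ)) * ‖hS.fieldVec n (fun _ => ()) W hW‖) →
      SandwichBound S hS μ (4 * CB) := by
  intro S hS hreg μ CB hμ hCB hyp u v hu hv hu1 hv1 f₁ g hh Mg Mh Mh' hf hg hgi hgM hhi hhM hhM' n W hW hFW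
  -- constants
  obtain ⟨h, hhdef⟩ : ∃ h : ℝ, h = min u v / 64 := ⟨_, rfl⟩
  have hh0 : 0 < h := by
    have := lt_min hu hv
    rw [hhdef]
    positivity
  have hδh : min u v / 32 = 2 * h := by rw [hhdef]; ring
  have hMh : 0 ≤ Mh := (integral_nonneg fun _ => norm_nonneg _).trans hhM
  have hMh' : 0 ≤ Mh' := (norm_nonneg _).trans (hhM' 0)
  have hMg : 0 ≤ Mg := (integral_nonneg fun _ => norm_nonneg _).trans hgM
  have hB : 0 ≤ (Mh + Mh') * (u ^ (-μ) + v ^ (-μ)) :=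
    mul_nonneg (add_nonneg hMh hMh') (add_nonneg (Real.rpow_nonneg hu.le _) (Real.rpow_nonneg hv.le _))
  -- the bump, the pieces, the cut-off clouds
  obtain ⟨θ, hθs, hθc, hθ0, hθ1, hθsupp, hθsum⟩ := exists_bump
  obtain ⟨fp, hfp⟩ := exists_pieces θ hθs hθc h f₁
  obtain ⟨χ, WK, hWK, hWKo, hWKc, hχ01, hχ1⟩ := exists_cutoff_clouds W hW
  have hwin : tsupport (f₁ : (Fin 1 → E4) → ℂ) ⊆ {x | u ≤ x 0 0 ∧ x 0 0 ≤ 2 * u} :=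
    tsupport_subset_window hf hg
  -- planar factors of the pieces
  obtain ⟨gp, hgpdef⟩ : ∃ gp : ℝ → ℝ → ℝ × ℝ → ℂ,
      ∀ a b q, gp a b q = ((θ (q.1 / h - a) * θ (q.2 / h - b) : ℝ) : ℂ) * g q := ⟨_, fun _ _ _ => rfl⟩
  have hfp' : ∀ a b x, fp a b x = gp a b (x 0 0, x 0 1) * hh (x 0 2, x 0 3) := by
    intro a b x
    rw [hfp, hf, hgpdef]
    ring
  have hgp_supp : ∀ a b q, gp a b q ≠ 0 →
      (|q.1 / h - a| < 1 ∧ |q.2 / h - b| < 1) ∧ (u ≤ q.1 ∧ q.1 ≤ 2 * u) := by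
    intro a b q hq
    rw [hgpdef] at hq
    have h1 := left_ne_zero_of_mul hq
    have h2 := right_ne_zero_of_mul hq
    rw [Complex.ofReal_ne_zero] at h1
    exact ⟨⟨hθsupp _ (left_ne_zero_of_mul h1), hθsupp _ (right_ne_zero_of_mul h1)⟩, hg q h2⟩
  have hmass : ∀ M : ℕ, (∀ a b : ℝ, Integrable (gp a b)) ∧
      ∑ p ∈ Finset.range (2 * M + 1) ×ˢ Finset.range (2 * M + 1),
        ∫ q, ‖gp ((p.1 : ℝ) - M) ((p.2 : ℝ) - M) q‖ ≤ ∫ q, ‖g q‖ := by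
    intro M
    have hm := sum_mass_le θ hθ0 hθ1 hθs.continuous (fun M t => (hθsum M t).2.1) hgi h M
    have e1 : ∀ a b, gp a b = fun q => ((θ (q.1 / h - a) * θ (q.2 / h - b) : ℝ) : ℂ) * g q :=
      fun a b => funext (hgpdef a b)
    simp only [e1]
    exact hm
  have hgpi : ∀ a b, Integrable (gp a b) := (hmass 0).1
  have hfp_win : ∀ a b, tsupport ((fp a b : 𝓢((Fin 1 → E4), ℂ)) : (Fin 1 → E4) → ℂ) ⊆
      {x | u ≤ x 0 0 ∧ x 0 0 ≤ 2 * u} := fun a b =>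
    tsupport_subset_window (hfp' a b) fun q hq => (hgp_supp a b q hq).2
  -- index sets, partial sums and their multipliers
  obtain ⟨I, hI⟩ : ∃ I : ℕ → Finset (ℕ × ℕ),
      ∀ M, I M = Finset.range (2 * M + 1) ×ˢ Finset.range (2 * M + 1) := ⟨_, fun _ => rfl⟩
  obtain ⟨FM, hFM⟩ : ∃ FM : ℕ → 𝓢((Fin 1 → E4), ℂ),
      ∀ M, FM M = ∑ p ∈ I M, fp ((p.1 : ℝ) - M) ((p.2 : ℝ) - M) := ⟨_, fun _ => rfl⟩
  obtain ⟨rM, hrM⟩ : ∃ rM : ℕ → (Fin 1 → E4) → ℝ, ∀ M x, rM M x =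
      (∑ k ∈ Finset.range (2 * M + 1), θ (x 0 0 / h - ((k : ℝ) - M))) *
        (∑ l ∈ Finset.range (2 * M + 1), θ (x 0 1 / h - ((l : ℝ) - M))) := ⟨_, fun _ _ => rfl⟩
  have hFM_apply : ∀ M x, FM M x = (rM M x : ℂ) * f₁ x := by
    intro M x
    rw [hFM, hrM, hI, sum_apply]
    simp only [hfp, Finset.sum_product, ← Finset.sum_mul]
    push_cast
    rw [Finset.sum_mul_sum]
  have hrM01 : ∀ M x, 0 ≤ rM M x ∧ rM M x ≤ 1 := fun M x => by
    rw [hrM]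
    exact ⟨mul_nonneg (hθsum M _).1 (hθsum M _).1,
      mul_le_one₀ (hθsum M _).2.1 (hθsum M _).1 (hθsum M _).2.1⟩
  have hrM1 : ∀ x, ∀ᶠ M in atTop, rM M x = 1 := by
    intro x
    obtain ⟨M₀, hM₀⟩ := exists_nat_ge (max |x 0 0 / h| |x 0 1 / h|)
    refine eventually_atTop.2 ⟨M₀, fun M hM => ?_⟩
    have hM' : (M₀ : ℝ) ≤ M := Nat.cast_le.2 hM
    have h0 : |x 0 0 / h| ≤ M := ((le_max_left _ _).trans hM₀).trans hM'
    have h1 : |x 0 1 / h| ≤ M := ((le_max_right _ _).trans hM₀).trans hM'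
    rw [hrM, (hθsum M _).2.2 h0, (hθsum M _).2.2 h1, one_mul]
  have hFM_win : ∀ M, tsupport ((FM M : 𝓢((Fin 1 → E4), ℂ)) : (Fin 1 → E4) → ℂ) ⊆
      {x | u ≤ x 0 0 ∧ x 0 0 ≤ 2 * u} := by
    intro M
    refine (closure_mono fun x hx => ?_).trans hwin
    rw [Function.mem_support] at hx ⊢
    intro h0
    exact hx (by rw [hFM_apply, h0, mul_zero])
  -- all the sandwiches are time-ordered
  set s : E4 := (2 * u + v) • EuclideanSpace.single 0 1 with hsdef
  have hXMK : ∀ M K, IsTimeOrdered ((FM M).appendTensor (translateMulti s (WK K))) := fun M K =>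
    isTimeOrdered_insertion hu hv (hFM_win M) (hWKo K)
  have hXp : ∀ a b K, IsTimeOrdered ((fp a b).appendTensor (translateMulti s (WK K))) := fun a b K =>
    isTimeOrdered_insertion hu hv (hfp_win a b) (hWKo K)
  -- Step 1: the bound for the partial sums against the cut-off clouds
  have step : ∀ ε : ℝ, 0 < ε → ∀ M K : ℕ,
      ‖hS.fieldVec (1 + n) (fun _ => ()) ((FM M).appendTensor (translateMulti s (WK K))) (hXMK M K)‖ ≤
        CB * (Mg + ε) * ((Mh + Mh') * (u ^ (-μ) + v ^ (-μ))) *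
          ‖hS.fieldVec n (fun _ => ()) (WK K) (hWKo K)‖ := by
    intro ε hε M K
    have hcard : (0 : ℝ) < (I M).card := by
      have : 0 < (I M).card := Finset.card_pos.2 ⟨(0, 0), by rw [hI]; simp⟩
      exact_mod_cast this
    obtain ⟨ε', hε'⟩ : ∃ ε' : ℝ, ε' = ε / (I M).card := ⟨_, rfl⟩
    have hε'0 : 0 < ε' := by rw [hε']; exact div_pos hε hcard
    -- every piece
    have hpiece : ∀ p ∈ I M,
        ‖hS.fieldVec (1 + n) (fun _ => ())
            ((fp ((p.1 : ℝ) - M) ((p.2 : ℝ) - M)).appendTensor (translateMulti s (WK K))) (hXp _ _ K)‖ ≤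
          CB * ((∫ q, ‖gp ((p.1 : ℝ) - M) ((p.2 : ℝ) - M) q‖) + ε') * (Mh + Mh') * (u ^ (-μ) + v ^ (-μ)) *
            ‖hS.fieldVec n (fun _ => ()) (WK K) (hWKo K)‖ := by
      intro p _
      obtain ⟨⟨huc, hc2⟩, hct⟩ := box_window (u := u) (v := v) (a := (p.1 : ℝ) - M) hh0 hδh
      refine piece_bound S hS μ CB hyp hu hv hu1 hv1 huc hc2 (b := ((p.2 : ℝ) - M) * h) (hfp' _ _)
        (fun q hq => ?_) (hgpi _ _) hhi hhM hhM' hε'0 (hWKo K) (hWKc K) (hXp _ _ K)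
      obtain ⟨⟨h1, h2⟩, h3, h4⟩ := hgp_supp _ _ q hq
      refine ⟨hct q.1 h1 h3 h4, ?_⟩
      have h5 : |q.2 - ((p.2 : ℝ) - M) * h| < h := by
        have : q.2 - ((p.2 : ℝ) - M) * h = (q.2 / h - ((p.2 : ℝ) - M)) * h := by
          field_simp
        rw [this, abs_mul, abs_of_pos hh0]
        calc |q.2 / h - ((p.2 : ℝ) - M)| * h < 1 * h := mul_lt_mul_of_pos_right h2 hh0
          _ = h := one_mul h
      linarith
    -- sum over the pieces
    have hsumeq : (FM M).appendTensor (translateMulti s (WK K)) =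
        ∑ p ∈ I M, (fp ((p.1 : ℝ) - M) ((p.2 : ℝ) - M)).appendTensor (translateMulti s (WK K)) := by
      rw [hFM]
      exact SchwartzMap.appendTensor_sum_left _ _ _
    have hs' : IsTimeOrdered
        (∑ p ∈ I M, (fp ((p.1 : ℝ) - M) ((p.2 : ℝ) - M)).appendTensor (translateMulti s (WK K))) := by
      rw [← hsumeq]
      exact hXMK M K
    have hm : ∑ p ∈ I M, ∫ q, ‖gp ((p.1 : ℝ) - M) ((p.2 : ℝ) - M) q‖ ≤ Mg := by
      rw [hI]
      exact (hmass M).2.trans hgM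
    have hcε : ((I M).card : ℝ) * ε' = ε := by
      rw [hε']
      field_simp
    have hfac : ∀ p : ℕ × ℕ, CB * ((∫ q, ‖gp ((p.1 : ℝ) - M) ((p.2 : ℝ) - M) q‖) + ε') * (Mh + Mh') *
        (u ^ (-μ) + v ^ (-μ)) * ‖hS.fieldVec n (fun _ => ()) (WK K) (hWKo K)‖ =
        ((∫ q, ‖gp ((p.1 : ℝ) - M) ((p.2 : ℝ) - M) q‖) + ε') *
          (CB * ((Mh + Mh') * (u ^ (-μ) + v ^ (-μ))) * ‖hS.fieldVec n (fun _ => ()) (WK K) (hWKo K)‖) :=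
      fun p => by ring
    calc ‖hS.fieldVec (1 + n) (fun _ => ()) ((FM M).appendTensor (translateMulti s (WK K))) (hXMK M K)‖
        = ‖hS.fieldVec (1 + n) (fun _ => ())
            (∑ p ∈ I M, (fp ((p.1 : ℝ) - M) ((p.2 : ℝ) - M)).appendTensor (translateMulti s (WK K))) hs'‖ :=
          congrArg _ (fieldVec_congr hS hsumeq _ _)
      _ ≤ ∑ p ∈ I M, ‖hS.fieldVec (1 + n) (fun _ => ())
            ((fp ((p.1 : ℝ) - M) ((p.2 : ℝ) - M)).appendTensor (translateMulti s (WK K))) (hXp _ _ K)‖ :=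
          norm_fieldVec_sum_le hS (I M) _ (fun p => hXp _ _ K) hs'
      _ ≤ ∑ p ∈ I M, CB * ((∫ q, ‖gp ((p.1 : ℝ) - M) ((p.2 : ℝ) - M) q‖) + ε') * (Mh + Mh') *
            (u ^ (-μ) + v ^ (-μ)) * ‖hS.fieldVec n (fun _ => ()) (WK K) (hWKo K)‖ := Finset.sum_le_sum hpiece
      _ = CB * ((∑ p ∈ I M, ∫ q, ‖gp ((p.1 : ℝ) - M) ((p.2 : ℝ) - M) q‖) + (I M).card * ε') *
            ((Mh + Mh') * (u ^ (-μ) + v ^ (-μ))) * ‖hS.fieldVec n (fun _ => ()) (WK K) (hWKo K)‖ := by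
          simp only [hfac]
          rw [← Finset.sum_mul, Finset.sum_add_distrib, Finset.sum_const, nsmul_eq_mul]
          ring
      _ ≤ CB * (Mg + ε) * ((Mh + Mh') * (u ^ (-μ) + v ^ (-μ))) *
            ‖hS.fieldVec n (fun _ => ()) (WK K) (hWKo K)‖ := by
          rw [hcε]
          have h1 : (∑ p ∈ I M, ∫ q, ‖gp ((p.1 : ℝ) - M) ((p.2 : ℝ) - M) q‖) + ε ≤ Mg + ε := by linarith
          exact mul_le_mul_of_nonneg_right (mul_le_mul_of_nonneg_right
            (mul_le_mul_of_nonneg_left h1 hCB) hB) (norm_nonneg _)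
  -- Step 2: the limits `K → ∞` (with `M = K`)
  have hlimW : Tendsto (fun K => ‖hS.fieldVec n (fun _ => ()) (WK K) (hWKo K)‖) atTop
      (𝓝 ‖hS.fieldVec n (fun _ => ()) W hW‖) :=
    tendsto_norm_fieldVec S hS hreg hW WK hWKo χ hWK hχ01 hχ1
  have hmult : ∀ (K : ℕ) (z : Fin (1 + n) → E4), (FM K).appendTensor (translateMulti s (WK K)) z =
      ((rM K (fun i => z (Fin.castAdd n i)) * χ K (fun j => z (Fin.natAdd 1 j) - s) : ℝ) : ℂ) *
        (f₁.appendTensor (translateMulti s W)) z := by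
    intro K z
    rw [SchwartzMap.appendTensor_apply, SchwartzMap.appendTensor_apply, translateMulti_apply,
      translateMulti_apply, hFM_apply, hWK]
    push_cast
    simp only [Function.comp_def]
    ring
  have hlimX : Tendsto
      (fun K => ‖hS.fieldVec (1 + n) (fun _ => ()) ((FM K).appendTensor (translateMulti s (WK K))) (hXMK K K)‖)
      atTop (𝓝 ‖hS.fieldVec (1 + n) (fun _ => ()) (f₁.appendTensor (translateMulti s W)) hFW‖) := by
    refine tendsto_norm_fieldVec S hS hreg hFW (fun K => (FM K).appendTensor (translateMulti s (WK K)))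
      (fun K => hXMK K K)
      (fun K z => rM K (fun i => z (Fin.castAdd n i)) * χ K (fun j => z (Fin.natAdd 1 j) - s))
      hmult (fun K z => ?_) (fun z => ?_)
    · exact ⟨mul_nonneg (hrM01 _ _).1 (hχ01 _ _).1, mul_le_one₀ (hrM01 _ _).2 (hχ01 _ _).1 (hχ01 _ _).2⟩
    · filter_upwards [hrM1 (fun i => z (Fin.castAdd n i)), hχ1 (fun j => z (Fin.natAdd 1 j) - s)]
        with K h1 h2
      rw [h1, h2, one_mul]
  -- Step 3: conclusion, `ε → 0` and the slack `4`
  have main : ‖hS.fieldVec (1 + n) (fun _ => ()) (f₁.appendTensor (translateMulti s W)) hFW‖ ≤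
      CB * Mg * (Mh + Mh') * (u ^ (-μ) + v ^ (-μ)) * ‖hS.fieldVec n (fun _ => ()) W hW‖ := by
    refine le_of_forall_pos_le_add fun ε hε => ?_
    obtain ⟨D, hD⟩ : ∃ D : ℝ,
        D = CB * ((Mh + Mh') * (u ^ (-μ) + v ^ (-μ))) * ‖hS.fieldVec n (fun _ => ()) W hW‖ := ⟨_, rfl⟩
    have hD0 : 0 ≤ D := by rw [hD]; positivity
    obtain ⟨ε', hε'⟩ : ∃ ε' : ℝ, ε' = ε / (D + 1) := ⟨_, rfl⟩
    have hε'0 : 0 < ε' := by rw [hε']; positivity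
    have hle := le_of_tendsto_of_tendsto' hlimX
      (hlimW.const_mul (CB * (Mg + ε') * ((Mh + Mh') * (u ^ (-μ) + v ^ (-μ))))) fun K => step ε' hε'0 K K
    have hεD : ε' * D ≤ ε := by
      rw [hε', div_mul_eq_mul_div, div_le_iff₀ (by positivity)]
      nlinarith
    calc ‖hS.fieldVec (1 + n) (fun _ => ()) (f₁.appendTensor (translateMulti s W)) hFW‖
        ≤ CB * (Mg + ε') * ((Mh + Mh') * (u ^ (-μ) + v ^ (-μ))) * ‖hS.fieldVec n (fun _ => ()) W hW‖ := hle
      _ = CB * Mg * (Mh + Mh') * (u ^ (-μ) + v ^ (-μ)) * ‖hS.fieldVec n (fun _ => ()) W hW‖ + ε' * D := by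
          rw [hD]; ring
      _ ≤ CB * Mg * (Mh + Mh') * (u ^ (-μ) + v ^ (-μ)) * ‖hS.fieldVec n (fun _ => ()) W hW‖ + ε := by
          linarith
  have h0 : 0 ≤ CB * Mg * (Mh + Mh') * (u ^ (-μ) + v ^ (-μ)) * ‖hS.fieldVec n (fun _ => ()) W hW‖ := by
    have := norm_nonneg (hS.fieldVec n (fun _ => ()) W hW)
    have h1 : 0 ≤ CB * Mg := mul_nonneg hCB hMg
    calc (0 : ℝ) = CB * Mg * ((Mh + Mh') * (u ^ (-μ) + v ^ (-μ))) * 0 := by ring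
      _ ≤ CB * Mg * ((Mh + Mh') * (u ^ (-μ) + v ^ (-μ))) * ‖hS.fieldVec n (fun _ => ()) W hW‖ :=
          mul_le_mul_of_nonneg_left this (mul_nonneg h1 hB)
      _ = _ := by ring
  calc ‖hS.fieldVec (1 + n) (fun _ => ()) (f₁.appendTensor (translateMulti s W)) hFW‖
      ≤ CB * Mg * (Mh + Mh') * (u ^ (-μ) + v ^ (-μ)) * ‖hS.fieldVec n (fun _ => ()) W hW‖ := main
    _ ≤ 4 * CB * Mg * (Mh + Mh') * (u ^ (-μ) + v ^ (-μ)) * ‖hS.fieldVec n (fun _ => ()) W hW‖ := by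
        nlinarith

end Summit.QuantumFields.YangMills.Theorems.SoftKernelBoostCovariance.Sketch

end
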